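import Mathlib
import Summits.Ventures.PercRepro2.Defs
import Summits.Ventures.PercRepro2.Independence
import Summits.Ventures.PercRepro2.Harris
import Summits.Ventures.PercRepro2.BoxUnionDefs
import Summits.Ventures.PercRepro2.BoxUnionShapeWitness

/-!
# The shape theorem for product measures — the 2-face witnesses
(blind cell PercRepro2, mine-1 g37; paper proof proofs/MINE1-BOXUNION-SHAPE.md, part B)

A *2-face* of the configuration cube `Config E = E → Bool` is the square
`{x, x[i↦1], x[j↦1], x[i↦1][j↦1]}` spanned at a configuration `x` with `x i = x j = false` by two
distinct coordinates `i ≠ j`.  The product weight with `p i = p j = 1/2` and `p e = x e ∈ {0, 1}`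
elsewhere (`IsProbVec`) is uniform on this face: `weight p ω = 1/4` on the four points and `0`
elsewhere (`weight_face`).  Consequently the restricted covariance
`∑_{ω ∈ U} weight p ω (f ω − E f)(g ω − E g)` is `1/4` times a four-term sum (`face_cov_sum`), and
for each of the five *bad traces* of `U` on the face — `{d}`, `{d'}`, `{d, d'}`, `{m, d, d'}`,
`{d, d', s}` (`m = x`, `d = x[i↦1]`, `d' = x[j↦1]`, `s = x[i↦1][j↦1]`) — there are increasing
indicators `f g` with NEGATIVE restricted covariance (`face_trace_*_witness`): the values are
`-1/32`, `-1/32`, `-1/8`, `-1/16`, `-1/16`.  These are the product-measure witnesses of the shape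
theorem (`BoxUnionShapePerc.lean`).
-/

namespace Summit.Ventures.PercRepro2

open Finset BoxUnion

open scoped Classical

noncomputable section

section Coordinates

variable {E : Type*}

/-- `a ≤ b` fails as soon as `a e = true` and `b e = false` at some coordinate. -/
lemma not_le_of_coord {a b : Config E} (e : E) (ha : a e = true) (hb : b e = false) :
    ¬ a ≤ b := fun h => by
  have := h e
  rw [ha, hb] at this
  exact Bool.false_ne_true (Bool.le_iff_imp.mp this rfl)

end Coordinates

section FaceBasic

variable {E : Type*} [DecidableEq E]

/-- A configuration agreeing with `x` off `{i, j}` is one of the four points of the face. -/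
lemma eq_face_of_agree {x ω : Config E} {i j : E} (hij : i ≠ j) (hxi : x i = false)
    (hxj : x j = false) (h : ∀ e, e ≠ i → e ≠ j → ω e = x e) :
    ω = x ∨ ω = Function.update x i true ∨ ω = Function.update x j true ∨
      ω = Function.update (Function.update x i true) j true := by
  have key : ω = Function.update (Function.update x i (ω i)) j (ω j) := by
    funext e
    by_cases hej : e = j
    · subst hej; simp
    · by_cases hei : e = i
      · subst hei; simp [Function.update_of_ne hij]
      · rw [Function.update_of_ne hej, Function.update_of_ne hei, h e hei hej]
  have e1 : Function.update x i false = x := Function.update_eq_self_iff.mpr hxi.symm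
  have e2 : Function.update x j false = x := Function.update_eq_self_iff.mpr hxj.symm
  have e3 : Function.update (Function.update x i true) j false = Function.update x i true :=
    Function.update_eq_self_iff.mpr (by rw [Function.update_of_ne hij.symm, hxj])
  rcases hi : ω i with _ | _ <;> rcases hj : ω j with _ | _ <;> rw [key, hi, hj]
  · left
    rw [e1, e2]
  · right; right; left
    rw [e1]
  · right; left
    exact e3
  · right; right; right
    rfl

/-- The four points of a face are pairwise distinct. -/
lemma face_distinct {x : Config E} {i j : E} (hij : i ≠ j) (hxi : x i = false)
    (hxj : x j = false) :
    x ≠ Function.update x i true ∧ x ≠ Function.update x j true ∧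
    x ≠ Function.update (Function.update x i true) j true ∧
    Function.update x i true ≠ Function.update x j true ∧
    Function.update x i true ≠ Function.update (Function.update x i true) j true ∧
    Function.update x j true ≠ Function.update (Function.update x i true) j true := by
  refine ⟨fun h => ?_, fun h => ?_, fun h => ?_, fun h => ?_, fun h => ?_, fun h => ?_⟩
  · have := congrFun h i; simp [hxi] at this
  · have := congrFun h j; simp [hxj] at this
  · have := congrFun h j; simp [hxj] at this
  · have := congrFun h i; simp [hij, hxi] at this
  · have := congrFun h j; simp [hij.symm, hxj] at this
  · have := congrFun h i; simp [hij, hxi] at this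

/-- The face weight is an admissible weight. -/
lemma isProbVec_face {x : Config E} {i j : E} {p : E → ℝ} (hpi : p i = 1 / 2)
    (hpj : p j = 1 / 2) (hpe : ∀ e, e ≠ i → e ≠ j → p e = if x e then 1 else 0) :
    IsProbVec p := by
  constructor
  · intro e
    by_cases hei : e = i
    · subst hei; rw [hpi]; norm_num
    by_cases hej : e = j
    · subst hej; rw [hpj]; norm_num
    rw [hpe e hei hej]; split_ifs <;> norm_num
  · intro e
    by_cases hei : e = i
    · subst hei; rw [hpi]; norm_num
    by_cases hej : e = j
    · subst hej; rw [hpj]; norm_num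
    rw [hpe e hei hej]; split_ifs <;> norm_num

/-- `x[i↦1] ≤ x[i↦1][j↦1]`. -/
lemma face_le_ij {x : Config E} {i j : E} :
    Function.update x i true ≤ Function.update (Function.update x i true) j true := by
  intro e
  simp only [Function.update_apply]
  split_ifs <;> simp

/-- `x[j↦1] ≤ x[i↦1][j↦1]`. -/
lemma face_le_ji {x : Config E} {i j : E} :
    Function.update x j true ≤ Function.update (Function.update x i true) j true := by
  intro e
  simp only [Function.update_apply]
  split_ifs <;> simp

end FaceBasic

section Face

variable {E : Type*} [Fintype E] [DecidableEq E]

/-- The face weight at a point of the face is `1/4`, off the face it is `0`. -/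
lemma weight_face {x : Config E} {i j : E} (hij : i ≠ j) {p : E → ℝ} (hpi : p i = 1 / 2)
    (hpj : p j = 1 / 2) (hpe : ∀ e, e ≠ i → e ≠ j → p e = if x e then 1 else 0) (ω : Config E) :
    weight p ω = if (∀ e, e ≠ i → e ≠ j → ω e = x e) then 1 / 4 else 0 := by
  unfold weight
  rw [← Finset.prod_mul_prod_compl ({i, j} : Finset E)]
  have h1 : ∏ e ∈ ({i, j} : Finset E), edgeFactor (p e) (ω e) = 1 / 4 := by
    rw [Finset.prod_pair hij, hpi, hpj]
    cases ω i <;> cases ω j <;> simp [edgeFactor] <;> norm_num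
  rw [h1]
  by_cases h : ∀ e, e ≠ i → e ≠ j → ω e = x e
  · rw [if_pos h]
    have h2 : ∏ e ∈ ({i, j} : Finset E)ᶜ, edgeFactor (p e) (ω e) = 1 := by
      apply Finset.prod_eq_one
      intro e he
      simp only [Finset.mem_compl, Finset.mem_insert, Finset.mem_singleton, not_or] at he
      rw [hpe e he.1 he.2, h e he.1 he.2]
      cases x e <;> simp [edgeFactor]
    rw [h2, mul_one]
  · rw [if_neg h]
    simp only [not_forall] at h
    obtain ⟨e, hei, hej, hne⟩ := h
    apply mul_eq_zero_of_right
    apply Finset.prod_eq_zero (i := e) (by simp [hei, hej])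
    rw [hpe e hei hej]
    cases hx : x e <;> cases hω : ω e <;> simp_all [edgeFactor]

/-- Expectation under the face weight is the average over the four points. -/
lemma expect_face {x : Config E} {i j : E} (hij : i ≠ j) (hxi : x i = false) (hxj : x j = false)
    {p : E → ℝ} (hpi : p i = 1 / 2) (hpj : p j = 1 / 2)
    (hpe : ∀ e, e ≠ i → e ≠ j → p e = if x e then 1 else 0) (f : Config E → ℝ) :
    expect p f = (f x + f (Function.update x i true) + f (Function.update x j true) +
      f (Function.update (Function.update x i true) j true)) / 4 := by
  obtain ⟨n1, n2, n3, n4, n5, n6⟩ := face_distinct hij hxi hxj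
  unfold expect
  rw [sum_four n1 n2 n3 n4 n5 n6 _ (fun ω hω => by
    have hw0 : weight p ω = 0 := by
      rw [weight_face hij hpi hpj hpe]
      exact if_neg (fun h => hω (by
        rcases eq_face_of_agree hij hxi hxj h with rfl | rfl | rfl | rfl <;> simp))
    rw [hw0, zero_mul])]
  have hw : ∀ ω ∈ ({x, Function.update x i true, Function.update x j true,
      Function.update (Function.update x i true) j true} : Finset (Config E)),
      weight p ω = 1 / 4 := by
    intro ω hω
    rw [weight_face hij hpi hpj hpe, if_pos]
    simp only [Finset.mem_insert, Finset.mem_singleton] at hω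
    intro e hei hej
    rcases hω with rfl | rfl | rfl | rfl <;> simp [hei, hej]
  rw [hw x (by simp), hw _ (by simp), hw _ (by simp), hw _ (by simp)]
  ring

/-- The restricted covariance under the face weight is `1/4` times the four-term sum. -/
lemma face_cov_sum {x : Config E} {i j : E} (hij : i ≠ j) (hxi : x i = false) (hxj : x j = false)
    {p : E → ℝ} (hpi : p i = 1 / 2) (hpj : p j = 1 / 2)
    (hpe : ∀ e, e ≠ i → e ≠ j → p e = if x e then 1 else 0) (U : Set (Config E))
    (f g : Config E → ℝ) :
    (∑ ω, if ω ∈ U then weight p ω * ((f ω - expect p f) * (g ω - expect p g)) else 0) =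
      1 / 4 * ((if x ∈ U then (f x - expect p f) * (g x - expect p g) else 0) +
        (if Function.update x i true ∈ U then
          (f (Function.update x i true) - expect p f) *
            (g (Function.update x i true) - expect p g) else 0) +
        (if Function.update x j true ∈ U then
          (f (Function.update x j true) - expect p f) *
            (g (Function.update x j true) - expect p g) else 0) +
        (if Function.update (Function.update x i true) j true ∈ U then
          (f (Function.update (Function.update x i true) j true) - expect p f) *
            (g (Function.update (Function.update x i true) j true) - expect p g) else 0)) := by
  obtain ⟨n1, n2, n3, n4, n5, n6⟩ := face_distinct hij hxi hxj
  rw [sum_four n1 n2 n3 n4 n5 n6 _ (fun ω hω => by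
    have hw0 : weight p ω = 0 := by
      rw [weight_face hij hpi hpj hpe]
      exact if_neg (fun h => hω (by
        rcases eq_face_of_agree hij hxi hxj h with rfl | rfl | rfl | rfl <;> simp))
    rw [hw0, zero_mul, ite_self])]
  have hw : ∀ ω ∈ ({x, Function.update x i true, Function.update x j true,
      Function.update (Function.update x i true) j true} : Finset (Config E)),
      weight p ω = 1 / 4 := by
    intro ω hω
    rw [weight_face hij hpi hpj hpe, if_pos]
    simp only [Finset.mem_insert, Finset.mem_singleton] at hω
    intro e hei hej
    rcases hω with rfl | rfl | rfl | rfl <;> simp [hei, hej]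
  rw [hw x (by simp), hw _ (by simp), hw _ (by simp), hw _ (by simp)]
  split_ifs <;> ring

/-! ### The five bad traces -/

/-- Trace `{d}`: `x, x[j↦1], x[i↦1][j↦1] ∉ U`, `x[i↦1] ∈ U`. -/
theorem face_trace_d_witness {x : Config E} {i j : E} (hij : i ≠ j) (hxi : x i = false)
    (hxj : x j = false) {U : Set (Config E)} (h0 : x ∉ U) (h1 : Function.update x i true ∈ U)
    (h2 : Function.update x j true ∉ U)
    (h3 : Function.update (Function.update x i true) j true ∉ U) :
    ∃ (p : E → ℝ) (f g : Config E → ℝ), IsProbVec p ∧ Monotone f ∧ Monotone g ∧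
      (∑ ω, if ω ∈ U then weight p ω * ((f ω - expect p f) * (g ω - expect p g)) else 0) < 0 := by
  have hpi : (fun e => if e = i ∨ e = j then (1 / 2 : ℝ) else if x e then 1 else 0) i = 1 / 2 := by
    simp
  have hpj : (fun e => if e = i ∨ e = j then (1 / 2 : ℝ) else if x e then 1 else 0) j = 1 / 2 := by
    simp
  have hpe : ∀ e, e ≠ i → e ≠ j →
      (fun e => if e = i ∨ e = j then (1 / 2 : ℝ) else if x e then 1 else 0) e =
        if x e then 1 else 0 := by
    intro e hei hej; simp [hei, hej]
  refine ⟨_, fun ω => if Function.update (Function.update x i true) j true ≤ ω then 1 else 0,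
    fun ω => if Function.update x i true ≤ ω then 1 else 0, isProbVec_face hpi hpj hpe,
    monotone_indicator_Ici _, monotone_indicator_Ici _, ?_⟩
  rw [face_cov_sum hij hxi hxj hpi hpj hpe, expect_face hij hxi hxj hpi hpj hpe,
    expect_face hij hxi hxj hpi hpj hpe]
  have a1 : ¬ Function.update (Function.update x i true) j true ≤ x :=
    not_le_of_coord i (by simp [hij]) hxi
  have a2 : ¬ Function.update (Function.update x i true) j true ≤ Function.update x i true :=
    not_le_of_coord j (by simp) (by simp [hij.symm, hxj])
  have a3 : ¬ Function.update (Function.update x i true) j true ≤ Function.update x j true :=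
    not_le_of_coord i (by simp [hij])
      (by simp [hij, hxi])
  have b1 : ¬ Function.update x i true ≤ x := not_le_of_coord i (by simp) hxi
  have b3 : ¬ Function.update x i true ≤ Function.update x j true :=
    not_le_of_coord i (by simp) (by simp [hij, hxi])
  simp only [h0, h1, h2, h3, a1, a2, a3, b1, b3, le_refl, face_le_ij, if_true, if_false]
  norm_num

/-- Trace `{d'}`: `x, x[i↦1], x[i↦1][j↦1] ∉ U`, `x[j↦1] ∈ U`. -/
theorem face_trace_d'_witness {x : Config E} {i j : E} (hij : i ≠ j) (hxi : x i = false)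
    (hxj : x j = false) {U : Set (Config E)} (h0 : x ∉ U) (h1 : Function.update x i true ∉ U)
    (h2 : Function.update x j true ∈ U)
    (h3 : Function.update (Function.update x i true) j true ∉ U) :
    ∃ (p : E → ℝ) (f g : Config E → ℝ), IsProbVec p ∧ Monotone f ∧ Monotone g ∧
      (∑ ω, if ω ∈ U then weight p ω * ((f ω - expect p f) * (g ω - expect p g)) else 0) < 0 := by
  have hpi : (fun e => if e = i ∨ e = j then (1 / 2 : ℝ) else if x e then 1 else 0) i = 1 / 2 := by
    simp
  have hpj : (fun e => if e = i ∨ e = j then (1 / 2 : ℝ) else if x e then 1 else 0) j = 1 / 2 := by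
    simp
  have hpe : ∀ e, e ≠ i → e ≠ j →
      (fun e => if e = i ∨ e = j then (1 / 2 : ℝ) else if x e then 1 else 0) e =
        if x e then 1 else 0 := by
    intro e hei hej; simp [hei, hej]
  refine ⟨_, fun ω => if Function.update (Function.update x i true) j true ≤ ω then 1 else 0,
    fun ω => if Function.update x j true ≤ ω then 1 else 0, isProbVec_face hpi hpj hpe,
    monotone_indicator_Ici _, monotone_indicator_Ici _, ?_⟩
  rw [face_cov_sum hij hxi hxj hpi hpj hpe, expect_face hij hxi hxj hpi hpj hpe,
    expect_face hij hxi hxj hpi hpj hpe]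
  have a1 : ¬ Function.update (Function.update x i true) j true ≤ x :=
    not_le_of_coord i (by simp [hij]) hxi
  have a2 : ¬ Function.update (Function.update x i true) j true ≤ Function.update x i true :=
    not_le_of_coord j (by simp) (by simp [hij.symm, hxj])
  have a3 : ¬ Function.update (Function.update x i true) j true ≤ Function.update x j true :=
    not_le_of_coord i (by simp [hij])
      (by simp [hij, hxi])
  have c1 : ¬ Function.update x j true ≤ x := not_le_of_coord j (by simp) hxj
  have c2 : ¬ Function.update x j true ≤ Function.update x i true :=
    not_le_of_coord j (by simp) (by simp [hij.symm, hxj])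
  simp only [h0, h1, h2, h3, a1, a2, a3, c1, c2, le_refl, face_le_ji, if_true, if_false]
  norm_num

/-- Trace `{d, d'}`: `x, x[i↦1][j↦1] ∉ U`, `x[i↦1], x[j↦1] ∈ U`. -/
theorem face_trace_dd'_witness {x : Config E} {i j : E} (hij : i ≠ j) (hxi : x i = false)
    (hxj : x j = false) {U : Set (Config E)} (h0 : x ∉ U) (h1 : Function.update x i true ∈ U)
    (h2 : Function.update x j true ∈ U)
    (h3 : Function.update (Function.update x i true) j true ∉ U) :
    ∃ (p : E → ℝ) (f g : Config E → ℝ), IsProbVec p ∧ Monotone f ∧ Monotone g ∧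
      (∑ ω, if ω ∈ U then weight p ω * ((f ω - expect p f) * (g ω - expect p g)) else 0) < 0 := by
  have hpi : (fun e => if e = i ∨ e = j then (1 / 2 : ℝ) else if x e then 1 else 0) i = 1 / 2 := by
    simp
  have hpj : (fun e => if e = i ∨ e = j then (1 / 2 : ℝ) else if x e then 1 else 0) j = 1 / 2 := by
    simp
  have hpe : ∀ e, e ≠ i → e ≠ j →
      (fun e => if e = i ∨ e = j then (1 / 2 : ℝ) else if x e then 1 else 0) e =
        if x e then 1 else 0 := by
    intro e hei hej; simp [hei, hej]
  refine ⟨_, fun ω => if Function.update x i true ≤ ω then 1 else 0,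
    fun ω => if Function.update x j true ≤ ω then 1 else 0, isProbVec_face hpi hpj hpe,
    monotone_indicator_Ici _, monotone_indicator_Ici _, ?_⟩
  rw [face_cov_sum hij hxi hxj hpi hpj hpe, expect_face hij hxi hxj hpi hpj hpe,
    expect_face hij hxi hxj hpi hpj hpe]
  have b1 : ¬ Function.update x i true ≤ x := not_le_of_coord i (by simp) hxi
  have b3 : ¬ Function.update x i true ≤ Function.update x j true :=
    not_le_of_coord i (by simp) (by simp [hij, hxi])
  have c1 : ¬ Function.update x j true ≤ x := not_le_of_coord j (by simp) hxj
  have c2 : ¬ Function.update x j true ≤ Function.update x i true :=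
    not_le_of_coord j (by simp) (by simp [hij.symm, hxj])
  simp only [h0, h1, h2, h3, b1, b3, c1, c2, le_refl, face_le_ij, face_le_ji, if_true,
    if_false]
  norm_num

/-- Trace `{m, d, d'}` (the face minus its top): `x, x[i↦1], x[j↦1] ∈ U`, `x[i↦1][j↦1] ∉ U`. -/
theorem face_trace_top_witness {x : Config E} {i j : E} (hij : i ≠ j) (hxi : x i = false)
    (hxj : x j = false) {U : Set (Config E)} (h0 : x ∈ U) (h1 : Function.update x i true ∈ U)
    (h2 : Function.update x j true ∈ U)
    (h3 : Function.update (Function.update x i true) j true ∉ U) :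
    ∃ (p : E → ℝ) (f g : Config E → ℝ), IsProbVec p ∧ Monotone f ∧ Monotone g ∧
      (∑ ω, if ω ∈ U then weight p ω * ((f ω - expect p f) * (g ω - expect p g)) else 0) < 0 := by
  have hpi : (fun e => if e = i ∨ e = j then (1 / 2 : ℝ) else if x e then 1 else 0) i = 1 / 2 := by
    simp
  have hpj : (fun e => if e = i ∨ e = j then (1 / 2 : ℝ) else if x e then 1 else 0) j = 1 / 2 := by
    simp
  have hpe : ∀ e, e ≠ i → e ≠ j →
      (fun e => if e = i ∨ e = j then (1 / 2 : ℝ) else if x e then 1 else 0) e =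
        if x e then 1 else 0 := by
    intro e hei hej; simp [hei, hej]
  refine ⟨_, fun ω => if Function.update x i true ≤ ω then 1 else 0,
    fun ω => if Function.update x j true ≤ ω then 1 else 0, isProbVec_face hpi hpj hpe,
    monotone_indicator_Ici _, monotone_indicator_Ici _, ?_⟩
  rw [face_cov_sum hij hxi hxj hpi hpj hpe, expect_face hij hxi hxj hpi hpj hpe,
    expect_face hij hxi hxj hpi hpj hpe]
  have b1 : ¬ Function.update x i true ≤ x := not_le_of_coord i (by simp) hxi
  have b3 : ¬ Function.update x i true ≤ Function.update x j true :=
    not_le_of_coord i (by simp) (by simp [hij, hxi])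
  have c1 : ¬ Function.update x j true ≤ x := not_le_of_coord j (by simp) hxj
  have c2 : ¬ Function.update x j true ≤ Function.update x i true :=
    not_le_of_coord j (by simp) (by simp [hij.symm, hxj])
  simp only [h0, h1, h2, h3, b1, b3, c1, c2, le_refl, face_le_ij, face_le_ji, if_true,
    if_false]
  norm_num

/-- Trace `{d, d', s}` (the face minus its bottom): `x ∉ U`, `x[i↦1], x[j↦1], x[i↦1][j↦1] ∈ U`. -/
theorem face_trace_bot_witness {x : Config E} {i j : E} (hij : i ≠ j) (hxi : x i = false)
    (hxj : x j = false) {U : Set (Config E)} (h0 : x ∉ U) (h1 : Function.update x i true ∈ U)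
    (h2 : Function.update x j true ∈ U)
    (h3 : Function.update (Function.update x i true) j true ∈ U) :
    ∃ (p : E → ℝ) (f g : Config E → ℝ), IsProbVec p ∧ Monotone f ∧ Monotone g ∧
      (∑ ω, if ω ∈ U then weight p ω * ((f ω - expect p f) * (g ω - expect p g)) else 0) < 0 := by
  have hpi : (fun e => if e = i ∨ e = j then (1 / 2 : ℝ) else if x e then 1 else 0) i = 1 / 2 := by
    simp
  have hpj : (fun e => if e = i ∨ e = j then (1 / 2 : ℝ) else if x e then 1 else 0) j = 1 / 2 := by
    simp
  have hpe : ∀ e, e ≠ i → e ≠ j →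
      (fun e => if e = i ∨ e = j then (1 / 2 : ℝ) else if x e then 1 else 0) e =
        if x e then 1 else 0 := by
    intro e hei hej; simp [hei, hej]
  refine ⟨_, fun ω => if Function.update x i true ≤ ω then 1 else 0,
    fun ω => if Function.update x j true ≤ ω then 1 else 0, isProbVec_face hpi hpj hpe,
    monotone_indicator_Ici _, monotone_indicator_Ici _, ?_⟩
  rw [face_cov_sum hij hxi hxj hpi hpj hpe, expect_face hij hxi hxj hpi hpj hpe,
    expect_face hij hxi hxj hpi hpj hpe]
  have b1 : ¬ Function.update x i true ≤ x := not_le_of_coord i (by simp) hxi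
  have b3 : ¬ Function.update x i true ≤ Function.update x j true :=
    not_le_of_coord i (by simp) (by simp [hij, hxi])
  have c1 : ¬ Function.update x j true ≤ x := not_le_of_coord j (by simp) hxj
  have c2 : ¬ Function.update x j true ≤ Function.update x i true :=
    not_le_of_coord j (by simp) (by simp [hij.symm, hxj])
  simp only [h0, h1, h2, h3, b1, b3, c1, c2, le_refl, face_le_ij, face_le_ji, if_true,
    if_false]
  norm_num

end Face

end

end Summit.Ventures.PercRepro2
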